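import Summits.ResolutionOfSingularities.ResolutionOfSingularities.Theorems.FrobeniusLadderFInjectiveMacaulayficationKLocCellRange
import HarnessLib

/-!
# E7 N5c — uniform Fedder cells «over `b` minus `V(P)`»: the chart clause at the maximal ideals over the centre that AVOID an
# ideal `P = (h₁, …, h_r)` (crux `FInjectiveMacaulayfication` stmt-ResolutionOfSingularities-15315, chain w45a; E7 CERT FORMAT
# `cover_target: over_b_minus_bad`; res-L1-w45a-plan-1 R12.60 (2) / R13.3 (C); owner res-D-pv-017 AS res-L1-w45a-stub-5)

Support file for crux stmt-ResolutionOfSingularities-15315 (`FrobeniusLadder.FInjectiveMacaulayfication`), chain w45a.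
[OURS · L1 W4.5a] — NOT a statement of any manuscript; AI-written, weaker than expert review.

The level-1 charts of a two-level tower have BAD points over the centre `b` (a curve `C̄ = V(P_c)` in chart `c`), so the uniform
cells of `KLocCell` (whose cofactor identity `1 = Σ rr·expand p c + Σ_{i∈S} t_i Y_i + t₀ g` excludes every bad point with `Y_S = 0`)
cannot exist on the strata meeting `C̄`. An **OFF-CELL** for a stratum `S` and an «avoid» polynomial `h` replaces `1` by a power
of `h`: `h ^ m = Σ rr·expand p c + Σ_{i∈S} t_i Y_i + t₀ g`. At a point `a` with `a_i = 0 (i ∈ S)`, `g(a) = 0` and `h(a) ≠ 0` some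
`(expand p c)(a) ≠ 0`, and Fedder's test follows exactly as in `KLocCell.fedderAt_of_kLocCell` (`fedderAt_of_kLocCell_gen`, stated
for an arbitrary left-hand side `u` with `u(a) ≠ 0`). Gluing (`pointFedder_of_kLocCells_off`, `honQuot_of_kLocCells_off`, and the
`Set.range` forms): if every zero pattern over `b` contains a standard-cell stratum OR an off-cell stratum certified for EVERY
generator `h ∈ hs` of `P`, then the Cohen–Macaulay + Frobenius-closed clause holds at every maximal `Q'` of `k[Y]/(g)` over `b`
with some `h ∈ hs` outside `Q'` — i.e. `¬ P ≤ Q'` — the `hchart` binder of N5d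
`TwoLevelTowerLevelOne.stalkClause_off_support_of_chartClauses` read on a toric chart. No definitions, no named facts.
[folklore; cite: Fedder1983, Prop. 1.7 and Thm. 1.12]
-/

-- single-problem summit: the doubled namespace component is forced
set_option linter.dupNamespace false

noncomputable section

namespace Summit.ResolutionOfSingularities.ResolutionOfSingularities.Theorems.FInjectiveMacaulayfication.KLocCellOff

open MvPolynomial
open Summit.ResolutionOfSingularities.ResolutionOfSingularities.Theorems.FInjectiveMacaulayfication
open Literature.RingTheory.TightClosure

/-! ## §1 The cofactor identity with a general left-hand side -/

/-- **The cofactor identity at a point of the stratum on `V(g)` off `V(u)`**: `u = Σ rr_e · expand p e.2 + Σ_{i ∈ S} t i · Y_i + t₀ · g`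
evaluated at `a` with `a_i = 0 (i ∈ S)`, `g(a) = 0`, `u(a) ≠ 0` leaves some `(expand p e.2)(a) ≠ 0`. [folklore] -/
theorem exists_aeval_expand_ne_zero_gen {p : ℕ} {k : Type} [Field k] {n : ℕ} (S : Finset (Fin n)) (g u : MvPolynomial (Fin n) k)
    (L : List ((Fin n →₀ ℕ) × MvPolynomial (Fin n) k)) (rr : List (MvPolynomial (Fin n) k))
    (t : Fin n → MvPolynomial (Fin n) k) (t₀ : MvPolynomial (Fin n) k)
    (hcof : u = (List.zipWith (fun r e => r * MvPolynomial.expand p e.2) rr L).sum +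
      ∑ i ∈ S, t i * MvPolynomial.X i + t₀ * g)
    {K : Type} [Field K] [Algebra k K] (a : Fin n → K) (haS : ∀ i ∈ S, a i = 0) (hga : MvPolynomial.aeval a g = 0)
    (hua : MvPolynomial.aeval a u ≠ 0) :
    ∃ e ∈ L, aeval a (MvPolynomial.expand p e.2) ≠ 0 := by
  by_contra hall
  push Not at hall
  have h := congrArg (MvPolynomial.aeval a) hcof
  rw [map_add, map_add, KLocCell.aeval_zipWith_sum_eq_zero p a rr L hall, map_sum, map_mul, hga, mul_zero, add_zero,
    zero_add] at h
  refine hua (h.trans (Finset.sum_eq_zero fun i hi => ?_))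
  rw [map_mul, MvPolynomial.aeval_X, haS i hi, mul_zero]

/-! ## §2 Fedder's test at every point of one stratum OFF `V(u)` from an off-cell -/

/-- **FEDDER'S TEST AT EVERY POINT OF ONE STRATUM OFF `V(u)`** — `KLocCell.fedderAt_of_kLocCell` with the cofactor identity's
left-hand side `1` replaced by an arbitrary `u` and the extra point hypothesis `u(a) ≠ 0`: with a distinct-exponent split
`g^(p-1) = Σ_{e ∈ L} Y^{e.1} · expand p e.2` (`e.1 < p`) and `u = Σ rr_e · expand p e.2 + Σ_{i∈S} t i · Y_i + t₀ · g`, for every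
field `K ⊇ k` and `K`-point `a` with `a_i = 0 (i ∈ S)`, `g(a) = 0`, `u(a) ≠ 0`: `(g ⊗ K)^(p-1) ∉ ((Y_i − a_i)^p : i)`.
[folklore; cite: Fedder1983, Prop. 1.7 (the test)] -/
theorem fedderAt_of_kLocCell_gen (p : ℕ) [Fact p.Prime] (k : Type) [Field k] [CharP k p] (n : ℕ)
    (S : Finset (Fin n)) (g u : MvPolynomial (Fin n) k)
    (L : List ((Fin n →₀ ℕ) × MvPolynomial (Fin n) k)) (rr : List (MvPolynomial (Fin n) k))
    (t : Fin n → MvPolynomial (Fin n) k) (t₀ : MvPolynomial (Fin n) k)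
    (hnd : (L.map Prod.fst).Nodup) (hbd : ∀ e ∈ L, ∀ i : Fin n, e.1 i < p)
    (hsplit : g ^ (p - 1) = (L.map fun e => MvPolynomial.monomial e.1 (1 : k) * MvPolynomial.expand p e.2).sum)
    (hcof : u = (List.zipWith (fun r e => r * MvPolynomial.expand p e.2) rr L).sum + ∑ i ∈ S, t i * MvPolynomial.X i + t₀ * g)
    (K : Type) [Field K] [Algebra k K] (a : Fin n → K) (haS : ∀ i ∈ S, a i = 0) (hga : MvPolynomial.aeval a g = 0)
    (hua : MvPolynomial.aeval a u ≠ 0) :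
    (MvPolynomial.map (algebraMap k K) g) ^ (p - 1) ∉
      Ideal.span (Set.range fun i : Fin n => (MvPolynomial.X i - MvPolynomial.C (a i)) ^ p) := by
  classical
  have hp : 0 < p := (Fact.out : p.Prime).pos
  -- residue classes of the (reduced) exponents
  let cls : (Fin n →₀ ℕ) → (Fin n → Fin p) := fun γ j => ⟨γ j % p, Nat.mod_lt _ hp⟩
  have hcls : ∀ e ∈ L, (Finsupp.equivFunOnFinite.symm fun j => ((cls e.1 j : ℕ)) : Fin n →₀ ℕ) = e.1 := by
    intro e he
    ext j
    simp only [Finsupp.coe_equivFunOnFinite_symm, cls]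
    exact Nat.mod_eq_of_lt (hbd e he j)
  have hinj : ∀ e ∈ L, ∀ e' ∈ L, cls e.1 = cls e'.1 → e = e' := by
    intro e he e' he' h
    have h2 := congrArg (fun β : Fin n → Fin p => (Finsupp.equivFunOnFinite.symm fun j => ((β j : ℕ)) : Fin n →₀ ℕ)) h
    rw [hcls e he, hcls e' he'] at h2
    exact List.inj_on_of_nodup_map hnd he he' h2
  have hL : L.Nodup := List.Nodup.of_map _ hnd
  -- the function-indexed split over the residue classes
  let c : (Fin n → Fin p) → MvPolynomial (Fin n) k := fun α => ∑ e ∈ L.toFinset with cls e.1 = α, e.2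
  have hF : g ^ (p - 1) = ∑ α : Fin n → Fin p, MvPolynomial.expand p (c α) *
      MvPolynomial.monomial (Finsupp.equivFunOnFinite.symm fun j => ((α j : ℕ))) 1 := by
    rw [hsplit, ← List.sum_toFinset _ hL]
    symm
    calc ∑ α : Fin n → Fin p, MvPolynomial.expand p (c α) *
          MvPolynomial.monomial (Finsupp.equivFunOnFinite.symm fun j => ((α j : ℕ))) 1
        = ∑ α : Fin n → Fin p, ∑ e ∈ L.toFinset with cls e.1 = α,
            MvPolynomial.monomial e.1 (1 : k) * MvPolynomial.expand p e.2 := by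
          refine Finset.sum_congr rfl fun α _ => ?_
          simp only [c, map_sum, Finset.sum_mul]
          refine Finset.sum_congr rfl fun e he => ?_
          rw [Finset.mem_filter] at he
          rw [mul_comm, ← he.2, hcls e (List.mem_toFinset.mp he.1)]
      _ = ∑ e ∈ L.toFinset, MvPolynomial.monomial e.1 (1 : k) * MvPolynomial.expand p e.2 :=
          Finset.sum_fiberwise L.toFinset (fun e => cls e.1) _
  -- a non-vanishing `p`-coefficient at `a`
  obtain ⟨e₀, he₀, hne⟩ := exists_aeval_expand_ne_zero_gen S g u L rr t t₀ hcof a haS hga hua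
  have hc : aeval a (MvPolynomial.expand p (c (cls e₀.1))) = aeval a (MvPolynomial.expand p e₀.2) := by
    simp only [c, map_sum]
    refine Finset.sum_eq_single_of_mem e₀ (Finset.mem_filter.mpr ⟨List.mem_toFinset.mpr he₀, rfl⟩) fun e he hne' => ?_
    exact absurd (hinj e (List.mem_toFinset.mp (Finset.mem_filter.mp he).1) e₀ he₀ (Finset.mem_filter.mp he).2) hne'
  exact FaceFPureOfMonomialPCoeff.fedder_of_aeval_expand_ne_zero p g c hF a ⟨cls e₀.1, by rw [hc]; exact hne⟩

/-! ## §3 The cover «standard strata ∪ off strata» and the cells ⟹ Fedder at every point over the centre off `V(hs)` -/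

section Chart

variable (p : ℕ) [Fact p.Prime] (k : Type) [Field k] [CharP k p] (n : ℕ)

/-- **THE MIXED COVER AND THE CELLS ⟹ FEDDER AT EVERY POINT OVER THE CENTRE OFF `V(hs)`.** Every zero pattern `T ⊆ Fin n` meeting
the support of each column `j ∈ J` of `V` contains a standard-cell stratum `S ∈ SS` OR an off-cell stratum `S ∈ SSoff`; every
standard stratum carries a `KLocCell` cell, every off stratum carries, for EVERY `h ∈ hs`, an off-cell with left-hand side `h ^ m`.
Then Fedder's test holds for `g ⊗ K` at every `K`-point `b` with `g(b) = 0`, `θ(X_j)(b) = 0 (j ∈ J)` and `h(b) ≠ 0` for some `h ∈ hs`.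
[folklore; cite: Fedder1983, Prop. 1.7] -/
theorem pointFedder_of_kLocCells_off (J : Finset (Fin n)) (V : Matrix (Fin n) (Fin n) ℕ) (g : MvPolynomial (Fin n) k)
    (SS SSoff : List (Finset (Fin n))) (hs : List (MvPolynomial (Fin n) k))
    (hcov : ∀ T : Finset (Fin n), (∀ j ∈ J, ∃ i ∈ T, 0 < V i j) → (∃ S ∈ SS, S ⊆ T) ∨ (∃ S ∈ SSoff, S ⊆ T))
    (hcells : ∀ S ∈ SS, ∃ (L : List ((Fin n →₀ ℕ) × MvPolynomial (Fin n) k)) (rr : List (MvPolynomial (Fin n) k))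
        (t : Fin n → MvPolynomial (Fin n) k) (t₀ : MvPolynomial (Fin n) k),
        (L.map Prod.fst).Nodup ∧ (∀ e ∈ L, ∀ i : Fin n, e.1 i < p) ∧
        g ^ (p - 1) = (L.map fun e => MvPolynomial.monomial e.1 (1 : k) * MvPolynomial.expand p e.2).sum ∧
        (1 : MvPolynomial (Fin n) k) = (List.zipWith (fun r e => r * MvPolynomial.expand p e.2) rr L).sum +
          ∑ i ∈ S, t i * MvPolynomial.X i + t₀ * g)
    (hcellsOff : ∀ S ∈ SSoff, ∀ h ∈ hs, ∃ (L : List ((Fin n →₀ ℕ) × MvPolynomial (Fin n) k)) (rr : List (MvPolynomial (Fin n) k))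
        (t : Fin n → MvPolynomial (Fin n) k) (t₀ : MvPolynomial (Fin n) k) (m : ℕ),
        (L.map Prod.fst).Nodup ∧ (∀ e ∈ L, ∀ i : Fin n, e.1 i < p) ∧
        g ^ (p - 1) = (L.map fun e => MvPolynomial.monomial e.1 (1 : k) * MvPolynomial.expand p e.2).sum ∧
        h ^ m = (List.zipWith (fun r e => r * MvPolynomial.expand p e.2) rr L).sum +
          ∑ i ∈ S, t i * MvPolynomial.X i + t₀ * g)
    (K : Type) [Field K] [Algebra k K] (b : Fin n → K) (hgb : MvPolynomial.aeval b g = 0)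
    (hθ : ∀ j ∈ J, MvPolynomial.aeval b (∏ i : Fin n, (X i : MvPolynomial (Fin n) k) ^ V i j) = 0)
    (hoff : ∃ h ∈ hs, MvPolynomial.aeval b h ≠ 0) :
    (MvPolynomial.map (algebraMap k K) g) ^ (p - 1) ∉
        Ideal.span (Set.range fun i : Fin n => (MvPolynomial.X i - MvPolynomial.C (b i)) ^ p) := by
  classical
  -- the orthant of `b` meets every column of `V` indexed by `J`
  have hT : ∀ j ∈ J, ∃ i ∈ (Finset.univ.filter fun i : Fin n => b i = 0), 0 < V i j := by
    intro j hj
    have h := hθ j hj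
    rw [map_prod, Finset.prod_eq_zero_iff] at h
    obtain ⟨i, -, hi⟩ := h
    rw [map_pow, MvPolynomial.aeval_X, pow_eq_zero_iff'] at hi
    exact ⟨i, Finset.mem_filter.mpr ⟨Finset.mem_univ i, hi.1⟩, Nat.pos_of_ne_zero hi.2⟩
  rcases hcov _ hT with ⟨S, hS, hST⟩ | ⟨S, hS, hST⟩
  · obtain ⟨L, rr, t, t₀, hnd, hbd, hsplit, hcof⟩ := hcells S hS
    exact KLocCell.fedderAt_of_kLocCell p k n S g L rr t t₀ hnd hbd hsplit hcof K b
      (fun i hi => (Finset.mem_filter.mp (hST hi)).2) hgb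
  · obtain ⟨h, hh, hhb⟩ := hoff
    obtain ⟨L, rr, t, t₀, m, hnd, hbd, hsplit, hcof⟩ := hcellsOff S hS h hh
    exact fedderAt_of_kLocCell_gen p k n S g (h ^ m) L rr t t₀ hnd hbd hsplit hcof K b
      (fun i hi => (Finset.mem_filter.mp (hST hi)).2) hgb (by rw [map_pow]; exact pow_ne_zero _ hhb)

/-! ## §4 The chart clause at the maximal ideals over the centre off `V(hs)` -/

/-- **`hon` OFF `V(hs)` FROM POINT-FEDDER OFF `V(hs)` (`Ideal.span {g}` form).** As `KLocCell.quotientChartClause_of_pointFedder`,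
with Fedder's test required only at the points `b` over the centre with `h(b) ≠ 0` for some `h ∈ hs`, and the conclusion only at
the maximal `Q' ∋ θ(X_j) (j ∈ J)` of `k[Y]/(g)` missing some `h ∈ hs`. [cite: Fedder1983, Prop. 1.7 and Thm. 1.12; folklore] -/
theorem quotientChartClause_of_pointFedder_off (J : Finset (Fin n)) (V : Matrix (Fin n) (Fin n) ℕ) (g : MvPolynomial (Fin n) k)
    (hg0 : g ≠ 0) (hX : ∀ i : Fin n, ¬ (MvPolynomial.X i ∣ g)) (hs : List (MvPolynomial (Fin n) k))
    (hfed : ∀ (K : Type) [Field K] [Algebra k K] (b : Fin n → K), MvPolynomial.aeval b g = 0 →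
      (∀ j ∈ J, MvPolynomial.aeval b (∏ i : Fin n, (X i : MvPolynomial (Fin n) k) ^ V i j) = 0) →
      (∃ h ∈ hs, MvPolynomial.aeval b h ≠ 0) →
      (MvPolynomial.map (algebraMap k K) g) ^ (p - 1) ∉
        Ideal.span (Set.range fun i : Fin n => (MvPolynomial.X i - MvPolynomial.C (b i)) ^ p)) :
    ∀ (Q' : Ideal (MvPolynomial (Fin n) k ⧸ Ideal.span {g})) [Q'.IsMaximal],
      (∀ j ∈ J, Ideal.Quotient.mk (Ideal.span {g})
        (aeval (fun j : Fin n => ∏ i : Fin n, (X i : MvPolynomial (Fin n) k) ^ V i j) (X j : MvPolynomial (Fin n) k)) ∈ Q') →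
      (∃ h ∈ hs, Ideal.Quotient.mk (Ideal.span {g}) h ∉ Q') →
        (∀ i : Fin n, (X i : MvPolynomial (Fin n) k) ∈ Q'.comap (Ideal.Quotient.mk (Ideal.span {g})) →
          IsSMulRegular (Localization.AtPrime (Q'.comap (Ideal.Quotient.mk (Ideal.span {g}))) ⧸
              (Ideal.span {g}).map (algebraMap (MvPolynomial (Fin n) k)
                (Localization.AtPrime (Q'.comap (Ideal.Quotient.mk (Ideal.span {g}))))))
            (algebraMap (MvPolynomial (Fin n) k)
              (Localization.AtPrime (Q'.comap (Ideal.Quotient.mk (Ideal.span {g})))) (X i))) ∧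
        ∀ dd : ℕ, ringKrullDim (Localization.AtPrime Q') = dd → ∀ s : Fin dd → Localization.AtPrime Q',
          (Ideal.span (Set.range s)).radical.IsMaximal →
            RingTheory.Sequence.IsWeaklyRegular (Localization.AtPrime Q') (List.ofFn s) ∧
            ∀ y : Localization.AtPrime Q', (∃ e : ℕ, y ^ p ^ e ∈ Ideal.span
              ((fun z : Localization.AtPrime Q' => z ^ p ^ e) ''
                (Ideal.span (Set.range s) : Set (Localization.AtPrime Q')))) → y ∈ Ideal.span (Set.range s) := by
  intro Q' _ hθ hhQ
  classical
  -- the contraction `P`, residue field `K = k[Y]/P`, residue point `b`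
  set P : Ideal (MvPolynomial (Fin n) k) := Q'.comap (Ideal.Quotient.mk (Ideal.span {g})) with hP_def
  haveI hPmax : P.IsMaximal := Ideal.comap_isMaximal_of_surjective _ Ideal.Quotient.mk_surjective
  refine ⟨fun i _ => KLocCell.isSMulRegular_localization_quotient_of_prime_not_dvd P (PrimeTransfer.prime_X i) (hX i) _ rfl, ?_⟩
  letI : Field (MvPolynomial (Fin n) k ⧸ P) := Ideal.Quotient.field P
  have hgP : g ∈ P := by
    rw [hP_def, Ideal.mem_comap, Ideal.Quotient.eq_zero_iff_mem.mpr (Ideal.mem_span_singleton_self g)]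
    exact Q'.zero_mem
  have haev : ∀ q : MvPolynomial (Fin n) k,
      MvPolynomial.aeval (fun i : Fin n => Ideal.Quotient.mk P (MvPolynomial.X i)) q = Ideal.Quotient.mk P q := by
    intro q
    have h : (MvPolynomial.aeval (R := k) (fun i : Fin n => Ideal.Quotient.mk P (MvPolynomial.X i))) =
        Ideal.Quotient.mkₐ k P := MvPolynomial.algHom_ext fun i => by
      rw [MvPolynomial.aeval_X, Ideal.Quotient.mkₐ_eq_mk]
    rw [h, Ideal.Quotient.mkₐ_eq_mk]
  have hgb : MvPolynomial.aeval (fun i : Fin n => Ideal.Quotient.mk P (MvPolynomial.X i)) g = 0 := by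
    rw [haev, Ideal.Quotient.eq_zero_iff_mem]; exact hgP
  have hθb : ∀ j ∈ J, MvPolynomial.aeval (fun i : Fin n => Ideal.Quotient.mk P (MvPolynomial.X i))
      (∏ i : Fin n, (X i : MvPolynomial (Fin n) k) ^ V i j) = 0 := by
    intro j hj
    rw [haev, Ideal.Quotient.eq_zero_iff_mem, hP_def, Ideal.mem_comap]
    have h := hθ j hj
    rwa [MvPolynomial.aeval_X] at h
  -- the residue point lies off `V(hs)`
  have hoffb : ∃ h ∈ hs, MvPolynomial.aeval (fun i : Fin n => Ideal.Quotient.mk P (MvPolynomial.X i)) h ≠ 0 := by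
    obtain ⟨h, hh, hhQ'⟩ := hhQ
    refine ⟨h, hh, fun h0 => hhQ' ?_⟩
    rw [haev, Ideal.Quotient.eq_zero_iff_mem, hP_def, Ideal.mem_comap] at h0
    exact h0
  -- Fedder at the residue point, `g^(p-1) ∉ P^[p]` (C3a), generators of `P`, then the clause
  have hfed' := hfed (MvPolynomial (Fin n) k ⧸ P) (fun i : Fin n => Ideal.Quotient.mk P (MvPolynomial.X i)) hgb hθb hoffb
  have hfrobP := FrobeniusPowerOfFedderAt.frobeniusPower_of_fedderAt p k n g P hfed'
  obtain ⟨m, gens, hgens⟩ := Submodule.fg_iff_exists_fin_generating_family.mp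
    ((isNoetherianRing_iff_ideal_fg _).mp inferInstance P)
  have hfed'' : g ^ (p - 1) ∉ Ideal.span (Set.range fun i : Fin m => gens i ^ p) := by
    intro h
    apply hfrobP
    refine (Ideal.span_le.mpr ?_) h
    rintro _ ⟨i, rfl⟩
    exact pow_mem_frobeniusPower (by rw [← hgens]; exact Submodule.subset_span ⟨i, rfl⟩)
  exact FedderAtMaximalIdeal.stub_fedderAtMaximalIdeal p k n m gens g Q' hgens.symm hg0 hfed''

/-- **(N5c, glued) THE CHART CLAUSE AT THE MAXIMAL IDEALS OVER THE CENTRE THAT AVOID `V(hs)`** (`Ideal.span {g}` form): for a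
chart polynomial `g ≠ 0` divisible by no variable, exceptional monomials `θ(X_j)` (`j ∈ J`), standard strata `SS` with `KLocCell`
cells, off strata `SSoff` with off-cells for every `h ∈ hs`, and the mixed cover condition, the clause of
`CICertificates.ciCertificates`' `hon'` holds at every maximal `Q' ∋ θ(X_j)` of `k[Y]/(g)` with some `h ∈ hs` outside `Q'`.
`pointFedder_of_kLocCells_off` ∘ `quotientChartClause_of_pointFedder_off`. [folklore; cite: Fedder1983, Prop. 1.7 and Thm. 1.12] -/
theorem honQuot_of_kLocCells_off (J : Finset (Fin n)) (V : Matrix (Fin n) (Fin n) ℕ) (g : MvPolynomial (Fin n) k)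
    (hg0 : g ≠ 0) (hX : ∀ i : Fin n, ¬ (MvPolynomial.X i ∣ g))
    (SS SSoff : List (Finset (Fin n))) (hs : List (MvPolynomial (Fin n) k))
    (hcov : ∀ T : Finset (Fin n), (∀ j ∈ J, ∃ i ∈ T, 0 < V i j) → (∃ S ∈ SS, S ⊆ T) ∨ (∃ S ∈ SSoff, S ⊆ T))
    (hcells : ∀ S ∈ SS, ∃ (L : List ((Fin n →₀ ℕ) × MvPolynomial (Fin n) k)) (rr : List (MvPolynomial (Fin n) k))
        (t : Fin n → MvPolynomial (Fin n) k) (t₀ : MvPolynomial (Fin n) k),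
        (L.map Prod.fst).Nodup ∧ (∀ e ∈ L, ∀ i : Fin n, e.1 i < p) ∧
        g ^ (p - 1) = (L.map fun e => MvPolynomial.monomial e.1 (1 : k) * MvPolynomial.expand p e.2).sum ∧
        (1 : MvPolynomial (Fin n) k) = (List.zipWith (fun r e => r * MvPolynomial.expand p e.2) rr L).sum +
          ∑ i ∈ S, t i * MvPolynomial.X i + t₀ * g)
    (hcellsOff : ∀ S ∈ SSoff, ∀ h ∈ hs, ∃ (L : List ((Fin n →₀ ℕ) × MvPolynomial (Fin n) k)) (rr : List (MvPolynomial (Fin n) k))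
        (t : Fin n → MvPolynomial (Fin n) k) (t₀ : MvPolynomial (Fin n) k) (m : ℕ),
        (L.map Prod.fst).Nodup ∧ (∀ e ∈ L, ∀ i : Fin n, e.1 i < p) ∧
        g ^ (p - 1) = (L.map fun e => MvPolynomial.monomial e.1 (1 : k) * MvPolynomial.expand p e.2).sum ∧
        h ^ m = (List.zipWith (fun r e => r * MvPolynomial.expand p e.2) rr L).sum +
          ∑ i ∈ S, t i * MvPolynomial.X i + t₀ * g) :
    ∀ (Q' : Ideal (MvPolynomial (Fin n) k ⧸ Ideal.span {g})) [Q'.IsMaximal],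
      (∀ j ∈ J, Ideal.Quotient.mk (Ideal.span {g})
        (aeval (fun j : Fin n => ∏ i : Fin n, (X i : MvPolynomial (Fin n) k) ^ V i j) (X j : MvPolynomial (Fin n) k)) ∈ Q') →
      (∃ h ∈ hs, Ideal.Quotient.mk (Ideal.span {g}) h ∉ Q') →
        (∀ i : Fin n, (X i : MvPolynomial (Fin n) k) ∈ Q'.comap (Ideal.Quotient.mk (Ideal.span {g})) →
          IsSMulRegular (Localization.AtPrime (Q'.comap (Ideal.Quotient.mk (Ideal.span {g}))) ⧸
              (Ideal.span {g}).map (algebraMap (MvPolynomial (Fin n) k)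
                (Localization.AtPrime (Q'.comap (Ideal.Quotient.mk (Ideal.span {g}))))))
            (algebraMap (MvPolynomial (Fin n) k)
              (Localization.AtPrime (Q'.comap (Ideal.Quotient.mk (Ideal.span {g})))) (X i))) ∧
        ∀ dd : ℕ, ringKrullDim (Localization.AtPrime Q') = dd → ∀ s : Fin dd → Localization.AtPrime Q',
          (Ideal.span (Set.range s)).radical.IsMaximal →
            RingTheory.Sequence.IsWeaklyRegular (Localization.AtPrime Q') (List.ofFn s) ∧
            ∀ y : Localization.AtPrime Q', (∃ e : ℕ, y ^ p ^ e ∈ Ideal.span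
              ((fun z : Localization.AtPrime Q' => z ^ p ^ e) ''
                (Ideal.span (Set.range s) : Set (Localization.AtPrime Q')))) → y ∈ Ideal.span (Set.range s) :=
  quotientChartClause_of_pointFedder_off p k n J V g hg0 hX hs fun K _ _ b hgb hθ hoff =>
    pointFedder_of_kLocCells_off p k n J V g SS SSoff hs hcov hcells hcellsOff K b hgb hθ hoff

/-- From `¬ (span hs)·(k[Y]/(g)) ≤ Q'` to a generator outside `Q'`. [folklore] -/
theorem exists_mk_not_mem_of_not_map_span_le {R : Type} [CommRing R] (I : Ideal R) (hs : List R) (Q' : Ideal (R ⧸ I))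
    (hQ : ¬ (Ideal.span {x | x ∈ hs}).map (Ideal.Quotient.mk I) ≤ Q') : ∃ h ∈ hs, Ideal.Quotient.mk I h ∉ Q' := by
  by_contra hall
  push Not at hall
  apply hQ
  rw [Ideal.map_span, Ideal.span_le]
  rintro _ ⟨h, hh, rfl⟩
  exact hall h hh

/-- **N5c in the `¬ P ≤ Q'` currency of N5d's `hchart`**: the same conclusion at every maximal `Q'` over the centre with
`¬ (span hs)·(k[Y]/(g)) ≤ Q'`. [folklore; cite: Fedder1983, Prop. 1.7 and Thm. 1.12] -/
theorem honQuot_of_kLocCells_off' (J : Finset (Fin n)) (V : Matrix (Fin n) (Fin n) ℕ) (g : MvPolynomial (Fin n) k)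
    (hg0 : g ≠ 0) (hX : ∀ i : Fin n, ¬ (MvPolynomial.X i ∣ g))
    (SS SSoff : List (Finset (Fin n))) (hs : List (MvPolynomial (Fin n) k))
    (hcov : ∀ T : Finset (Fin n), (∀ j ∈ J, ∃ i ∈ T, 0 < V i j) → (∃ S ∈ SS, S ⊆ T) ∨ (∃ S ∈ SSoff, S ⊆ T))
    (hcells : ∀ S ∈ SS, ∃ (L : List ((Fin n →₀ ℕ) × MvPolynomial (Fin n) k)) (rr : List (MvPolynomial (Fin n) k))
        (t : Fin n → MvPolynomial (Fin n) k) (t₀ : MvPolynomial (Fin n) k),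
        (L.map Prod.fst).Nodup ∧ (∀ e ∈ L, ∀ i : Fin n, e.1 i < p) ∧
        g ^ (p - 1) = (L.map fun e => MvPolynomial.monomial e.1 (1 : k) * MvPolynomial.expand p e.2).sum ∧
        (1 : MvPolynomial (Fin n) k) = (List.zipWith (fun r e => r * MvPolynomial.expand p e.2) rr L).sum +
          ∑ i ∈ S, t i * MvPolynomial.X i + t₀ * g)
    (hcellsOff : ∀ S ∈ SSoff, ∀ h ∈ hs, ∃ (L : List ((Fin n →₀ ℕ) × MvPolynomial (Fin n) k)) (rr : List (MvPolynomial (Fin n) k))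
        (t : Fin n → MvPolynomial (Fin n) k) (t₀ : MvPolynomial (Fin n) k) (m : ℕ),
        (L.map Prod.fst).Nodup ∧ (∀ e ∈ L, ∀ i : Fin n, e.1 i < p) ∧
        g ^ (p - 1) = (L.map fun e => MvPolynomial.monomial e.1 (1 : k) * MvPolynomial.expand p e.2).sum ∧
        h ^ m = (List.zipWith (fun r e => r * MvPolynomial.expand p e.2) rr L).sum +
          ∑ i ∈ S, t i * MvPolynomial.X i + t₀ * g) :
    ∀ (Q' : Ideal (MvPolynomial (Fin n) k ⧸ Ideal.span {g})) [Q'.IsMaximal],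
      (∀ j ∈ J, Ideal.Quotient.mk (Ideal.span {g})
        (aeval (fun j : Fin n => ∏ i : Fin n, (X i : MvPolynomial (Fin n) k) ^ V i j) (X j : MvPolynomial (Fin n) k)) ∈ Q') →
      ¬ (Ideal.span {x | x ∈ hs}).map (Ideal.Quotient.mk (Ideal.span {g})) ≤ Q' →
        ∀ dd : ℕ, ringKrullDim (Localization.AtPrime Q') = dd → ∀ s : Fin dd → Localization.AtPrime Q',
          (Ideal.span (Set.range s)).radical.IsMaximal →
            RingTheory.Sequence.IsWeaklyRegular (Localization.AtPrime Q') (List.ofFn s) ∧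
            ∀ y : Localization.AtPrime Q', (∃ e : ℕ, y ^ p ^ e ∈ Ideal.span
              ((fun z : Localization.AtPrime Q' => z ^ p ^ e) ''
                (Ideal.span (Set.range s) : Set (Localization.AtPrime Q')))) → y ∈ Ideal.span (Set.range s) :=
  fun Q' _ hθ hQ => (honQuot_of_kLocCells_off p k n J V g hg0 hX SS SSoff hs hcov hcells hcellsOff Q' hθ
    (exists_mk_not_mem_of_not_map_span_le _ hs Q' hQ)).2

end Chart

end Summit.ResolutionOfSingularities.ResolutionOfSingularities.Theorems.FInjectiveMacaulayfication.KLocCellOff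

end
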